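import Summits.SmoothPoincare4.SmoothPoincare4.Theses.WeylBudget
import Summits.SmoothPoincare4.SmoothPoincare4.Theorems.WeylBudgetCorkRegluingBudgetCollarGluingIsometric
import Summits.SmoothPoincare4.SmoothPoincare4.Theorems.WeylBudgetCorkRegluingBudgetWeylAdditivity

/-!
# Over-generality certificate for the RESHAPE 4/5 form of Stub F^W (crux `CorkRegluingBudget`, line `registered`)

Crux `Summit.SmoothPoincare4.SmoothPoincare4.Theses.WeylBudget.CorkRegluingBudget`
(stmt-SmoothPoincare4-10831, route WeylBudget), line `registered` = `Lines/birth.lean`.  This file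
is EVIDENCE (a crux workfile), not a Theorems proposal.  It kernel-checks the reduction behind
RESHAPE 6 (lead c3, `Lines/registered-lead-c3-analysis.md` §1):

* `weylLightPsc_twistedGluing_of_backToBackData` — back-to-back Bär–Hanke data `(g_C, g_W)` over a
  common τ-invariant boundary form with τ-invariant `μ_C` (the CONCLUSION of Stub F^W for
  `(C, W, φ, τ)`) are also back-to-back data for the twisted identification `φ ∘ τ`; hence, by the
  landed `stub_collarGluingIsometric` (p164488) and `stub_weylAdditivity` (p165130), the twisted
  gluing `X_τ = C ∪_{φτ} W` is a compact smooth 4-manifold carrying a Riemannian PSC metric with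
  `∫|W|² ≤ 𝒲(g_C) + 𝒲(g_W) < 32π²`.  No hypothesis on `C` (contractible or not) and no reference
  to `S⁴` is needed.
* `weylLightPsc_twistedGluing_of_stubFW_unrestricted` — consequently the RESHAPE 4/5 stub
  (`StubFWUnrestricted`, verbatim its registered signature: NO `ContractibleSpace C`) puts a
  Weyl-light PSC metric (`∫|W|² < 32π² = 16π²χ(X_τ)`, `χ(X_τ) = χ(S⁴) = 2`) on EVERY involutive
  regluing of the 4-sphere along ANY closed separating hypersurface.  For the unknotted
  `T³ = ∂(T² × D²) ⊂ S⁴` and `τ` the swap of the meridian with a torus direction one gets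
  `H₁(X_τ; ℤ) ≅ ℤ`, contradicting Chang–Gursky–Yang's Theorem A (`X_τ ≅ S⁴` or `ℝP⁴`); that
  topological witness is on paper (analysis §1), the reduction here is kernel-checked.

Axioms: propext, Classical.choice, Quot.sound (no sorry).
-/

set_option linter.dupNamespace false

open scoped Manifold ContDiff Topology
open Set Function

noncomputable section

namespace Summit.SmoothPoincare4.SmoothPoincare4.Cruxes.CorkRegluingBudget.Overgeneral

open Literature.Topology.FourManifolds Literature.Geometry.Lorentzian
open Summit.SmoothPoincare4.SmoothPoincare4.Theorems.CorkRegluingBudget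

/-- **Back-to-back data glue along the twisted identification as well.**  Let `C`, `W` be
compact smooth 4-manifolds with boundary, `φ : ∂C ≅ ∂W`, `τ` an involution of `∂C`, and let
`g_C`, `g_W` be Riemannian PSC metrics in umbilic `C₀`-normal form on closed collars, back to back
(`μ_W ∘ φ = -μ_C`) over a common boundary form (`ι_C^* g_C = (ι_W φ)^* g_W`) with `τ^* h_C = h_C`
and `μ_C ∘ τ = μ_C` — exactly the conclusion of Stub F^W.  Then the same data are back-to-back
data for `φ ∘ τ`, so the TWISTED gluing `X_τ = C ∪_{φτ} W` is a compact smooth closed 4-manifold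
with a Riemannian PSC metric of Weyl energy `≤ 𝒲(g_C) + 𝒲(g_W)` (collar gluing p164488 + Weyl
additivity p165130; the chain rule `(ι_W φ τ)^* g_W = τ^* (ι_W φ)^* g_W` for the rewiring).
[cite: BarHanke2023, §3 Cor. 34] [cite: ONeill1983, Ch. 3, p. 58] -/
theorem weylLightPsc_twistedGluing_of_backToBackData
    (C : Type) [TopologicalSpace C] [T2Space C] [SecondCountableTopology C]
    [ChartedSpace (EuclideanHalfSpace 4) C] [IsManifold (𝓡∂ 4) ∞ C] [CompactSpace C]
    (bC : BoundaryData (𝓡∂ 4) C (𝓡 3))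
    (W : Type) [TopologicalSpace W] [T2Space W] [SecondCountableTopology W]
    [ChartedSpace (EuclideanHalfSpace 4) W] [IsManifold (𝓡∂ 4) ∞ W] [CompactSpace W]
    (bW : BoundaryData (𝓡∂ 4) W (𝓡 3))
    (φ : bC.carrier ≃ₘ⟮𝓡 3, 𝓡 3⟯ bW.carrier) (τ : bC.carrier ≃ₘ⟮𝓡 3, 𝓡 3⟯ bC.carrier)
    (hτ : ∀ z, τ (τ z) = z)
    (gC : PseudoRiemannianMetric (𝓡∂ 4) ∞ (EuclideanSpace ℝ (Fin 4)) (TangentSpace (𝓡∂ 4) : C → Type _))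
    [gC.HasLeviCivita]
    (gW : PseudoRiemannianMetric (𝓡∂ 4) ∞ (EuclideanSpace ℝ (Fin 4)) (TangentSpace (𝓡∂ 4) : W → Type _))
    [gW.HasLeviCivita]
    (μC : bC.carrier → ℝ) (μW : bW.carrier → ℝ) (C₀ ε : ℝ) (cC : bC.Collar) (cW : bW.Collar)
    (hRC : gC.IsRiemannian) (hSC : ∀ x, 0 < gC.scalarCurvature x)
    (hRW : gW.IsRiemannian) (hSW : ∀ x, 0 < gW.scalarCurvature x)
    (hε : 0 < ε) (hμ : ContMDiff (𝓡 3) 𝓘(ℝ, ℝ) ∞ μC) (hμτ : ∀ z, μC (τ z) = μC z)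
    (hμW : ∀ z, μW (φ z) = -μC z)
    (hτh : ∀ z, pullbackBilin (I := 𝓡∂ 4) (I' := 𝓡 3) (bC.incl ∘ τ) gC.val z =
      pullbackBilin (I := 𝓡∂ 4) (I' := 𝓡 3) bC.incl gC.val z)
    (hCW : ∀ z, pullbackBilin (I := 𝓡∂ 4) (I' := 𝓡 3) bC.incl gC.val z =
      pullbackBilin (I := 𝓡∂ 4) (I' := 𝓡 3) (bW.incl ∘ φ) gW.val z)
    (hcC : ∀ (p : bC.carrier × Set.Icc (0 : ℝ) 1) (V V' : TangentSpace ((𝓡 3).prod (𝓡∂ 1)) p),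
      pullbackBilin (I := 𝓡∂ 4) (I' := (𝓡 3).prod (𝓡∂ 1)) cC gC.val p V V' =
        ε ^ 2 * ((show EuclideanSpace ℝ (Fin 1) from V.2) 0 *
          (show EuclideanSpace ℝ (Fin 1) from V'.2) 0) +
        (1 - 2 * μC p.1 * (ε * (p.2 : ℝ)) - C₀ * (ε * (p.2 : ℝ)) ^ 2) *
          pullbackBilin (I := 𝓡∂ 4) (I' := 𝓡 3) bC.incl gC.val p.1 V.1 V'.1)
    (hcW : ∀ (q : bW.carrier × Set.Icc (0 : ℝ) 1) (V V' : TangentSpace ((𝓡 3).prod (𝓡∂ 1)) q),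
      pullbackBilin (I := 𝓡∂ 4) (I' := (𝓡 3).prod (𝓡∂ 1)) cW gW.val q V V' =
        ε ^ 2 * ((show EuclideanSpace ℝ (Fin 1) from V.2) 0 *
          (show EuclideanSpace ℝ (Fin 1) from V'.2) 0) +
        (1 - 2 * μW q.1 * (ε * (q.2 : ℝ)) - C₀ * (ε * (q.2 : ℝ)) ^ 2) *
          pullbackBilin (I := 𝓡∂ 4) (I' := 𝓡 3) bW.incl gW.val q.1 V.1 V'.1) :
    ∃ (P : Type) (_ : TopologicalSpace P) (_ : T2Space P) (_ : SecondCountableTopology P)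
      (_ : ChartedSpace (EuclideanSpace ℝ (Fin 4)) P) (_ : IsManifold (𝓡 4) ∞ P),
      CompactSpace P ∧ IsBoundaryGluing bC bW (τ.trans φ) (𝓡 4) P ∧
      ∃ g : PseudoRiemannianMetric (𝓡 4) ∞ (EuclideanSpace ℝ (Fin 4)) (TangentSpace (𝓡 4) : P → Type _),
        ∃ _ : g.HasLeviCivita, g.IsRiemannian ∧ (∀ x, 0 < g.scalarCurvature x) ∧
          g.weylEnergy ≤ gC.weylEnergy + gW.weylEnergy := by
  -- smoothness of the boundary maps
  have hinclC : MDifferentiable (𝓡 3) (𝓡∂ 4) bC.incl :=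
    bC.isSmoothEmbedding.contMDiff.mdifferentiable (by simp)
  have hinclW : MDifferentiable (𝓡 3) (𝓡∂ 4) bW.incl :=
    bW.isSmoothEmbedding.contMDiff.mdifferentiable (by simp)
  have hτd : MDifferentiable (𝓡 3) (𝓡 3) τ := τ.contMDiff.mdifferentiable (by simp)
  have hφd : MDifferentiable (𝓡 3) (𝓡 3) φ := φ.contMDiff.mdifferentiable (by simp)
  have hWφ : MDifferentiable (𝓡 3) (𝓡∂ 4) (bW.incl ∘ φ) := hinclW.comp hφd
  -- the rewired hypotheses for the twisted identification `φ ∘ τ`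
  have hμW' : ∀ z, μW ((τ.trans φ) z) = -μC z := fun z ↦ by
    rw [Diffeomorph.coe_trans, comp_apply, hμW, hμτ]
  have hfun : pullbackBilin (I := 𝓡∂ 4) (I' := 𝓡 3) (bW.incl ∘ φ) gW.val =
      pullbackBilin (I := 𝓡∂ 4) (I' := 𝓡 3) bC.incl gC.val := (funext hCW).symm
  have hCW' : ∀ z, pullbackBilin (I := 𝓡∂ 4) (I' := 𝓡 3) bC.incl gC.val z =
      pullbackBilin (I := 𝓡∂ 4) (I' := 𝓡 3) (bW.incl ∘ ⇑(τ.trans φ)) gW.val z := by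
    have key : (bW.incl ∘ ⇑(τ.trans φ)) = (bW.incl ∘ φ) ∘ τ := by
      rw [Diffeomorph.coe_trans]; rfl
    intro z
    rw [key, pullbackBilin_comp (I := 𝓡 3) (I' := 𝓡 3) (I'' := 𝓡∂ 4) hWφ hτd, hfun,
      ← pullbackBilin_comp (I := 𝓡 3) (I' := 𝓡 3) (I'' := 𝓡∂ 4) hinclC hτd]
    exact (hτh z).symm
  -- glue along `φ ∘ τ`
  obtain ⟨P, tP, t2P, scP, chP, mP, jC, jW, ⟨hjC, hjW, hcov, hseam⟩, g, U, T, hg, ⟨hLC, hscal⟩,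
    -, -, -, -, -, -, -, -, hpC, hpW⟩ :=
    stub_collarGluingIsometric C bC W bW (τ.trans φ) τ hτ gC gW μC μW C₀ ε cC cW hRC hSC hRW hSW
      hε hμ hμτ hμW' hτh hCW' hcC hcW
  haveI := hLC
  have hcpt : CompactSpace P := ⟨by
    rw [← hcov]
    exact (isCompact_range hjC.contMDiff.continuous).union
      (isCompact_range hjW.contMDiff.continuous)⟩
  have hseam' : ∀ c w, jC c = jW w → c ∈ (𝓡∂ 4).boundary C := fun c w h ↦ by
    obtain ⟨z, rfl, -⟩ := (hseam c w).1 h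
    exact bC.incl_mem_boundary z
  exact ⟨P, tP, t2P, scP, chP, mP, hcpt, ⟨jC, jW, hjC, hjW, hcov, hseam⟩, g, hLC, hg, hscal,
    stub_weylAdditivity C W P jC jW gC gW g hjC hjW hcov hseam' hRC hRW hg hpC hpW⟩

/-- **The RESHAPE 4/5 form of Stub F^W, as a proposition** (verbatim the signature registered by
lead c2, `Lines/birth.lean` sha 82a37bf9 — NO `ContractibleSpace C`): for every smooth splitting
`S⁴ = C ∪_φ W` along a closed hypersurface and every involution `τ` of `∂C`, back-to-back
Bär–Hanke PSC fill-ins over a common τ-invariant boundary form with `𝒲(g_C) + 𝒲(g_W) < 32π²`. -/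
def StubFWUnrestricted : Prop :=
    ∀ (C : Type) [TopologicalSpace C] [T2Space C] [SecondCountableTopology C]
    [ChartedSpace (EuclideanHalfSpace 4) C] [IsManifold (𝓡∂ 4) ∞ C] [CompactSpace C]
    (bC : Literature.Topology.FourManifolds.BoundaryData (𝓡∂ 4) C (𝓡 3))
    (W : Type) [TopologicalSpace W] [T2Space W] [SecondCountableTopology W]
    [ChartedSpace (EuclideanHalfSpace 4) W] [IsManifold (𝓡∂ 4) ∞ W] [CompactSpace W]
    (bW : Literature.Topology.FourManifolds.BoundaryData (𝓡∂ 4) W (𝓡 3))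
    (φ : bC.carrier ≃ₘ⟮𝓡 3, 𝓡 3⟯ bW.carrier) (τ : bC.carrier ≃ₘ⟮𝓡 3, 𝓡 3⟯ bC.carrier),
      (∀ z, τ (τ z) = z) →
      Literature.Topology.FourManifolds.IsBoundaryGluing bC bW φ (𝓡 4)
          (Metric.sphere (0 : EuclideanSpace ℝ (Fin 5)) 1) →
      ∃ (gC : Literature.Geometry.Lorentzian.PseudoRiemannianMetric (𝓡∂ 4) ∞ (EuclideanSpace ℝ (Fin 4))
          (TangentSpace (𝓡∂ 4) : C → Type _)) (_ : gC.HasLeviCivita)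
        (gW : Literature.Geometry.Lorentzian.PseudoRiemannianMetric (𝓡∂ 4) ∞ (EuclideanSpace ℝ (Fin 4))
          (TangentSpace (𝓡∂ 4) : W → Type _)) (_ : gW.HasLeviCivita)
        (μC : bC.carrier → ℝ) (μW : bW.carrier → ℝ) (C₀ ε : ℝ) (cC : bC.Collar) (cW : bW.Collar),
        gC.IsRiemannian ∧ (∀ x, 0 < gC.scalarCurvature x) ∧
        gW.IsRiemannian ∧ (∀ x, 0 < gW.scalarCurvature x) ∧
        0 < ε ∧ ContMDiff (𝓡 3) 𝓘(ℝ, ℝ) ∞ μC ∧ (∀ z, μC (τ z) = μC z) ∧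
        (∀ z, μW (φ z) = -μC z) ∧
        (∀ z, Literature.Geometry.Lorentzian.pullbackBilin (I := 𝓡∂ 4) (I' := 𝓡 3) (bC.incl ∘ τ) gC.val z =
          Literature.Geometry.Lorentzian.pullbackBilin (I := 𝓡∂ 4) (I' := 𝓡 3) bC.incl gC.val z) ∧
        (∀ z, Literature.Geometry.Lorentzian.pullbackBilin (I := 𝓡∂ 4) (I' := 𝓡 3) bC.incl gC.val z =
          Literature.Geometry.Lorentzian.pullbackBilin (I := 𝓡∂ 4) (I' := 𝓡 3) (bW.incl ∘ φ) gW.val z) ∧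
        (∀ (p : bC.carrier × Set.Icc (0 : ℝ) 1) (V V' : TangentSpace ((𝓡 3).prod (𝓡∂ 1)) p),
          Literature.Geometry.Lorentzian.pullbackBilin (I := 𝓡∂ 4) (I' := (𝓡 3).prod (𝓡∂ 1)) cC gC.val p V V' =
            ε ^ 2 * ((show EuclideanSpace ℝ (Fin 1) from V.2) 0 *
              (show EuclideanSpace ℝ (Fin 1) from V'.2) 0) +
            (1 - 2 * μC p.1 * (ε * (p.2 : ℝ)) - C₀ * (ε * (p.2 : ℝ)) ^ 2) *
              Literature.Geometry.Lorentzian.pullbackBilin (I := 𝓡∂ 4) (I' := 𝓡 3) bC.incl gC.val p.1 V.1 V'.1) ∧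
        (∀ (q : bW.carrier × Set.Icc (0 : ℝ) 1) (V V' : TangentSpace ((𝓡 3).prod (𝓡∂ 1)) q),
          Literature.Geometry.Lorentzian.pullbackBilin (I := 𝓡∂ 4) (I' := (𝓡 3).prod (𝓡∂ 1)) cW gW.val q V V' =
            ε ^ 2 * ((show EuclideanSpace ℝ (Fin 1) from V.2) 0 *
              (show EuclideanSpace ℝ (Fin 1) from V'.2) 0) +
            (1 - 2 * μW q.1 * (ε * (q.2 : ℝ)) - C₀ * (ε * (q.2 : ℝ)) ^ 2) *
              Literature.Geometry.Lorentzian.pullbackBilin (I := 𝓡∂ 4) (I' := 𝓡 3) bW.incl gW.val q.1 V.1 V'.1) ∧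
        gC.weylEnergy + gW.weylEnergy < ENNReal.ofReal (32 * Real.pi ^ 2)

/-- **The unrestricted F^W makes every involutive regluing of the 4-sphere Weyl-light PSC.**
For every smooth splitting `S⁴ = C ∪_φ W` along a closed hypersurface (no contractibility) and
every involution `τ` of `∂C`, the twisted gluing `X_τ = C ∪_{φτ} W` is a compact smooth closed
4-manifold carrying a Riemannian PSC metric with `∫|W|² < 32π² = 16π²χ(X_τ)`.  With the
unknotted `T³ ⊂ S⁴` and the swap involution (`H₁(X_τ) ≅ ℤ`) this contradicts Chang–Gursky–Yang's
Theorem A (closed 4-manifold, positive Yamabe class, `∫|W|² < 16π²χ` ⟹ diffeomorphic to `S⁴`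
or `ℝP⁴`): the reason for RESHAPE 6. [cite: ChangGurskyYang2003, Thm A] -/
theorem weylLightPsc_twistedGluing_of_stubFW_unrestricted (h : StubFWUnrestricted) :
    ∀ (C : Type) [TopologicalSpace C] [T2Space C] [SecondCountableTopology C]
    [ChartedSpace (EuclideanHalfSpace 4) C] [IsManifold (𝓡∂ 4) ∞ C] [CompactSpace C]
    (bC : BoundaryData (𝓡∂ 4) C (𝓡 3))
    (W : Type) [TopologicalSpace W] [T2Space W] [SecondCountableTopology W]
    [ChartedSpace (EuclideanHalfSpace 4) W] [IsManifold (𝓡∂ 4) ∞ W] [CompactSpace W]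
    (bW : BoundaryData (𝓡∂ 4) W (𝓡 3))
    (φ : bC.carrier ≃ₘ⟮𝓡 3, 𝓡 3⟯ bW.carrier) (τ : bC.carrier ≃ₘ⟮𝓡 3, 𝓡 3⟯ bC.carrier),
      (∀ z, τ (τ z) = z) →
      IsBoundaryGluing bC bW φ (𝓡 4) (Metric.sphere (0 : EuclideanSpace ℝ (Fin 5)) 1) →
      ∃ (P : Type) (_ : TopologicalSpace P) (_ : T2Space P) (_ : SecondCountableTopology P)
        (_ : ChartedSpace (EuclideanSpace ℝ (Fin 4)) P) (_ : IsManifold (𝓡 4) ∞ P),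
        CompactSpace P ∧ IsBoundaryGluing bC bW (τ.trans φ) (𝓡 4) P ∧
        ∃ g : PseudoRiemannianMetric (𝓡 4) ∞ (EuclideanSpace ℝ (Fin 4)) (TangentSpace (𝓡 4) : P → Type _),
          ∃ _ : g.HasLeviCivita, g.IsRiemannian ∧ (∀ x, 0 < g.scalarCurvature x) ∧
            g.weylEnergy < ENNReal.ofReal (32 * Real.pi ^ 2) := by
  intro C _ _ _ _ _ _ bC W _ _ _ _ _ _ bW φ τ hτ hS4
  obtain ⟨gC, hLCC, gW, hLCW, μC, μW, C₀, ε, cC, cW, hRC, hSC, hRW, hSW, hε, hμ, hμτ, hμW, hτh,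
    hCW, hcC, hcW, hbudget⟩ := h C bC W bW φ τ hτ hS4
  haveI := hLCC
  haveI := hLCW
  obtain ⟨P, tP, t2P, scP, chP, mP, hcpt, hglue, g, hLC, hg, hscal, hweyl⟩ :=
    weylLightPsc_twistedGluing_of_backToBackData C bC W bW φ τ hτ gC gW μC μW C₀ ε cC cW hRC hSC
      hRW hSW hε hμ hμτ hμW hτh hCW hcC hcW
  exact ⟨P, tP, t2P, scP, chP, mP, hcpt, hglue, g, hLC, hg, hscal, hweyl.trans_lt hbudget⟩

end Summit.SmoothPoincare4.SmoothPoincare4.Cruxes.CorkRegluingBudget.Overgeneral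

end
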